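import Summits.ResolutionOfSingularities.ResolutionOfSingularities.Theorems.PurelyInseparableDim4IsolatedPowerIdeal
import Literature.AlgebraicGeometry.Resolution.HasseSchmidtCoefficients
import HarnessLib
import HarnessLib.Audit.Tags

/-!
# Purely inseparable four-folds — SINGLE-LETTER HASSE CALCULUS: Leibniz in one letter, `D_c^{(i)}(h^d) ∈ (h^{d−i})`,
# and the two leading congruences (slice-B architecture, input of (K8); cell `res-dim4-pi`, K2(p) lane)

[OURS · counted 0 · cell `res-dim4-pi` · SLICE-B ARCHITECTURE OF RECORD `SLICE-B-ARCH-g3.md` v1.1 (desk WORDs #88/#90),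
brick (K8) part 1; seat res-dim4-p-12 g3.]  Nothing here proves K2(p), `NoIsolatedTrap p p` or resolution of
singularities in dimension ≥ 4 / characteristic `p`.  AI kernel work, weaker than expert review.

For the PIDim4 Hasse derivative `hasseDeriv (single c n)` (= the tree's `Resolution.hasseDeriv K (single c n)`,
`Equimultiple.hasseDeriv_eq`) in ONE letter `c`:
* `hasseDeriv_single_mul` — Leibniz `D_c^{(n)}(PQ) = Σ_{i ≤ n} D_c^{(i)}P · D_c^{(n−i)}Q` (range form);
* `hasseDeriv_single_X_of_ne`, `hasseDeriv_single_X_mul_of_ne` — `x_a` (`a ≠ c`) is a constant for `D_c`;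
* `hasseDeriv_single_pow_mem_span` — `D_c^{(i)}(h^d) ∈ (h^{d−i})` (from `…IsolatedPowerIdeal`'s sharp Leibniz);
* **`hasseDeriv_single_pow_congr`** — `D_c^{(m)}(h^m) ≡ (D_c^{(1)}h)^m (mod h)` and
  `D_c^{(m−1)}(h^m) ≡ m·h·(D_c^{(1)}h)^{m−1} (mod h²)` (`m ≥ 1`), jointly by induction on `m`.
Every field, every characteristic.  bears_on: LADDER-RESOLUTION:D157-DOOR2 (res-dim4-pi · K2(p) slice B · (K8)).
Supports stmt-ResolutionOfSingularities-16155 (helper).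
-/

set_option linter.dupNamespace false -- mandated namespace of this single-conjunct summit

noncomputable section

namespace Summit.ResolutionOfSingularities.ResolutionOfSingularities.Theorems.PIDim4

namespace IsolatedBand

open MvPolynomial Finset
open Literature.AlgebraicGeometry.Resolution

variable {K : Type} [Field K]

/-! ## 1. Single-letter Hasse calculus -/

/-- **Single-letter Leibniz**: `D_c^{(n)}(PQ) = Σ_{i ≤ n} D_c^{(i)}P · D_c^{(n−i)}Q`. [folklore]
[cite: EGAIV4, Thm. 16.11.2 (16.11.2.2)] -/
theorem hasseDeriv_single_mul (c : Fin 4) (n : ℕ) (P Q : MvPolynomial (Fin 4) K) :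
    hasseDeriv (Finsupp.single c n) (P * Q) =
      ∑ i ∈ Finset.range (n + 1), hasseDeriv (Finsupp.single c i) P * hasseDeriv (Finsupp.single c (n - i)) Q := by
  classical
  rw [Equimultiple.hasseDeriv_eq, Literature.AlgebraicGeometry.Resolution.hasseDeriv_mul, Finsupp.antidiagonal_single,
    Finset.sum_map, Finset.Nat.sum_antidiagonal_eq_sum_range_succ_mk]
  refine Finset.sum_congr rfl fun i _ => ?_
  rw [Equimultiple.hasseDeriv_eq, Equimultiple.hasseDeriv_eq]
  rfl

/-- `D_c^{(i)}` kills a different variable for `i ≥ 1` and fixes it for `i = 0`. [folklore] -/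
theorem hasseDeriv_single_X_of_ne {c a : Fin 4} (hca : c ≠ a) (i : ℕ) :
    hasseDeriv (Finsupp.single c i) (X a : MvPolynomial (Fin 4) K) = if i = 0 then X a else 0 := by
  classical
  rw [Equimultiple.hasseDeriv_eq, Literature.AlgebraicGeometry.Resolution.hasseDeriv_X]
  by_cases hi : i = 0
  · rw [if_pos hi, hi, Finsupp.single_zero, if_pos rfl, if_neg, add_zero]
    intro h
    have := congrArg (fun f : Fin 4 →₀ ℕ => f a) h
    simp at this
  · rw [if_neg hi, if_neg (Finsupp.single_ne_zero.mpr hi), if_neg, add_zero]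
    intro h
    have := congrArg (fun f : Fin 4 →₀ ℕ => f c) h
    simp [Finsupp.single_eq_of_ne hca] at this
    exact hi this

/-- `D_c^{(n)}(x_a · S) = x_a · D_c^{(n)} S` for `c ≠ a`. [folklore] -/
theorem hasseDeriv_single_X_mul_of_ne {c a : Fin 4} (hca : c ≠ a) (n : ℕ) (S : MvPolynomial (Fin 4) K) :
    hasseDeriv (Finsupp.single c n) (X a * S) = X a * hasseDeriv (Finsupp.single c n) S := by
  rw [hasseDeriv_single_mul, Finset.sum_eq_single 0]
  · rw [hasseDeriv_single_X_of_ne hca, if_pos rfl, Nat.sub_zero]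
  · intro i _ hi
    rw [hasseDeriv_single_X_of_ne hca, if_neg hi, zero_mul]
  · intro h; exact absurd (Finset.mem_range.mpr (Nat.succ_pos n)) h

/-- `D^{(0)} = id`. [folklore] -/
theorem hasseDeriv_single_zero' (c : Fin 4) (P : MvPolynomial (Fin 4) K) :
    hasseDeriv (Finsupp.single c 0) P = P := by
  rw [Equimultiple.hasseDeriv_eq, Finsupp.single_zero, Literature.AlgebraicGeometry.Resolution.hasseDeriv_zero,
    LinearMap.id_apply]

/-- `D_c^{(i)}(h^d) ∈ (h^{d−i})`. [folklore] -/
theorem hasseDeriv_single_pow_mem_span (c : Fin 4) (i d : ℕ) (h : MvPolynomial (Fin 4) K) :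
    hasseDeriv (Finsupp.single c i) (h ^ d) ∈ Ideal.span {h ^ (d - i)} := by
  by_cases hid : i ≤ d
  · have hmem := hasseDeriv_mem_pow_sub_of_mem_pow (Ideal.span {h}) d (Finsupp.single c i)
      (by rw [Finsupp.degree_single]; exact hid) (h ^ d)
      (by rw [Ideal.span_singleton_pow]; exact Ideal.mem_span_singleton_self _)
    rwa [Finsupp.degree_single, Ideal.span_singleton_pow] at hmem
  · push Not at hid
    rw [Nat.sub_eq_zero_of_le hid.le, pow_zero, Ideal.span_singleton_one]
    exact Submodule.mem_top

/-- Shrinking the exponent: `(h^j) ⊆ (h^k)` for `k ≤ j`. [folklore] -/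
theorem mem_span_pow_of_le {h x : MvPolynomial (Fin 4) K} {j k : ℕ} (hx : x ∈ Ideal.span {h ^ j}) (hkj : k ≤ j) :
    x ∈ Ideal.span {h ^ k} :=
  Ideal.span_singleton_le_span_singleton.mpr (pow_dvd_pow h hkj) hx

/-- **The two leading congruences**: `D_c^{(m)}(h^m) ≡ (D_c^{(1)} h)^m (mod h)` and
`D_c^{(m−1)}(h^m) ≡ m·h·(D_c^{(1)} h)^{m−1} (mod h²)` (`m ≥ 1`). [folklore] -/
theorem hasseDeriv_single_pow_congr (c : Fin 4) (h : MvPolynomial (Fin 4) K) :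
    ∀ m : ℕ, 1 ≤ m →
      hasseDeriv (Finsupp.single c m) (h ^ m) - hasseDeriv (Finsupp.single c 1) h ^ m ∈ Ideal.span {h} ∧
      hasseDeriv (Finsupp.single c (m - 1)) (h ^ m) -
        (m : MvPolynomial (Fin 4) K) * h * hasseDeriv (Finsupp.single c 1) h ^ (m - 1) ∈ Ideal.span {h ^ 2} := by
  intro m hm
  induction m with
  | zero => exact absurd hm (by omega)
  | succ m ih =>
    rcases Nat.eq_zero_or_pos m with hm0 | hmpos
    · subst hm0
      refine ⟨?_, ?_⟩
      · rw [zero_add, pow_one, pow_one, sub_self]; exact Ideal.zero_mem _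
      · rw [zero_add, Nat.sub_self, pow_one, pow_zero, hasseDeriv_single_zero', Nat.cast_one, one_mul, mul_one,
          sub_self]; exact Ideal.zero_mem _
    · obtain ⟨hQ, hP⟩ := ih hmpos
      have hh : h ∈ Ideal.span {h} := Ideal.mem_span_singleton_self h
      constructor
      · -- `D^{(m+1)}(h · h^m) = h·D^{(m+1)}(h^m) + hasseDeriv (Finsupp.single c 1) h·D^{(m)}(h^m) + Σ_{i ≥ 2} D^{(i)}h · D^{(m+1−i)}(h^m)`
        have hexp := hasseDeriv_single_mul c (m + 1) h (h ^ m)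
        rw [← pow_succ', Finset.sum_range_succ', Finset.sum_range_succ'] at hexp
        simp only [Nat.sub_zero, zero_add, hasseDeriv_single_zero', Nat.add_sub_cancel] at hexp
        rw [hexp]
        have hrest : ∑ i ∈ Finset.range m,
            hasseDeriv (Finsupp.single c (i + 1 + 1)) h * hasseDeriv (Finsupp.single c (m + 1 - (i + 1 + 1))) (h ^ m) ∈
            Ideal.span {h} := by
          refine Ideal.sum_mem _ fun i hi => Ideal.mul_mem_left _ _ ?_
          rw [Finset.mem_range] at hi
          have hm := mem_span_pow_of_le (hasseDeriv_single_pow_mem_span c (m + 1 - (i + 1 + 1)) m h)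
            (show 1 ≤ m - (m + 1 - (i + 1 + 1)) by omega)
          rwa [pow_one] at hm
        -- `hasseDeriv (Finsupp.single c 1) h · D^{(m)}(h^m) − hasseDeriv (Finsupp.single c 1) h^{m+1} = hasseDeriv (Finsupp.single c 1) h · (D^{(m)}(h^m) − hasseDeriv (Finsupp.single c 1) h^m)`
        have h1 : hasseDeriv (Finsupp.single c 1) h * hasseDeriv (Finsupp.single c m) (h ^ m) - hasseDeriv (Finsupp.single c 1) h ^ (m + 1) ∈ Ideal.span {h} := by
          rw [pow_succ', ← mul_sub]; exact Ideal.mul_mem_left _ _ hQ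
        have h0 : h * hasseDeriv (Finsupp.single c (m + 1)) (h ^ m) ∈ Ideal.span {h} := Ideal.mul_mem_right _ _ hh
        have := Ideal.add_mem _ (Ideal.add_mem _ hrest h1) h0
        convert this using 1
        ring
      · rw [Nat.add_sub_cancel]
        have hexp := hasseDeriv_single_mul c m h (h ^ m)
        rw [← pow_succ'] at hexp
        obtain ⟨m', rfl⟩ : ∃ m', m = m' + 1 := ⟨m - 1, by omega⟩
        rw [Finset.sum_range_succ', Finset.sum_range_succ'] at hexp
        simp only [Nat.sub_zero, zero_add, hasseDeriv_single_zero', Nat.add_sub_cancel] at hexp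
        rw [hexp]
        rw [Nat.add_sub_cancel] at hP
        have hrest : ∑ i ∈ Finset.range m',
            hasseDeriv (Finsupp.single c (i + 1 + 1)) h * hasseDeriv (Finsupp.single c (m' + 1 - (i + 1 + 1))) (h ^ (m' + 1)) ∈
            Ideal.span {h ^ 2} := by
          refine Ideal.sum_mem _ fun i hi => Ideal.mul_mem_left _ _ ?_
          rw [Finset.mem_range] at hi
          exact mem_span_pow_of_le (hasseDeriv_single_pow_mem_span c (m' + 1 - (i + 1 + 1)) (m' + 1) h)
            (show 2 ≤ m' + 1 - (m' + 1 - (i + 1 + 1)) by omega)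
        -- `i = 1`: `hasseDeriv (Finsupp.single c 1) h · (D^{(m')}(h^{m'+1}) − (m'+1) h hasseDeriv (Finsupp.single c 1) h^{m'}) ∈ (h²)`
        have h1 : hasseDeriv (Finsupp.single c 1) h * hasseDeriv (Finsupp.single c m') (h ^ (m' + 1)) -
            hasseDeriv (Finsupp.single c 1) h * (((m' + 1 : ℕ) : MvPolynomial (Fin 4) K) * h * hasseDeriv (Finsupp.single c 1) h ^ m') ∈ Ideal.span {h ^ 2} := by
          rw [← mul_sub]; exact Ideal.mul_mem_left _ _ hP
        -- `i = 0`: `h · (D^{(m'+1)}(h^{m'+1}) − hasseDeriv (Finsupp.single c 1) h^{m'+1}) ∈ (h²)`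
        have h0 : h * hasseDeriv (Finsupp.single c (m' + 1)) (h ^ (m' + 1)) - h * hasseDeriv (Finsupp.single c 1) h ^ (m' + 1) ∈
            Ideal.span {h ^ 2} := by
          rw [← mul_sub]
          obtain ⟨R, hR⟩ := Ideal.mem_span_singleton'.mp hQ
          rw [← hR, pow_two]
          exact Ideal.mem_span_singleton'.mpr ⟨R, by ring⟩
        have := Ideal.add_mem _ (Ideal.add_mem _ hrest h1) h0
        convert this using 1
        push_cast
        ring

end IsolatedBand

end Summit.ResolutionOfSingularities.ResolutionOfSingularities.Theorems.PIDim4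

end
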